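import Literature.Combinatorics.LorentzianPolynomials.RayleighOperations
import Literature.Probability.NegativeDependence.RayleighMeasures
import HarnessLib

/-!
# `c`-Rayleigh multi-affine polynomials: the pairwise criterion, and `1`-Rayleigh = Rayleigh measures
# (Brändén–Huh 2020, §2.4, the remark after Def. 2.18)

Layer `Literature/Combinatorics/LorentzianPolynomials` (Brändén–Huh, `IsCRayleigh c f`, Def. 2.18: all `∂^α`, all
`i, j`, closed orthant) meets `Literature/Probability/NegativeDependence` (Borcea–Brändén–Liggett Def. 2.5,
`IsRayleigh μ`: the weight `μ` on `2^σ` with generating polynomial `multiAffine μ = Σ_S μ(S) z^S`, Rayleigh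
differences on the open orthant). Source (verbatim) — P. Brändén, J. Huh, *Lorentzian polynomials*
[BrandenHuh2019] (held `paper:arxiv-1902.03719`), §2.4 (p. 19):

> **Definition 2.18.** We say that `f` is `c`-Rayleigh if `f` has nonnegative coefficients and
> `∂^α f(w) ∂^{α+e_i+e_j} f(w) ≤ c ∂^{α+e_i} f(w) ∂^{α+e_j} f(w)` for all `i, j ∈ [n]`, `α ∈ ℕ^n`, `w ∈ ℝ^n_{≥0}`.
> When `f` is the partition function of a discrete probability measure `μ`, the `c`-Rayleigh condition captures a
> negative dependence property of `μ`. More precisely, when `f` is *multi-affine*, that is, when `f` has degree at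
> most one in each variable, the `c`-Rayleigh condition for `f` is equivalent to
> `f(w) ∂_i∂_j f(w) ≤ c ∂_i f(w) ∂_j f(w)` for all distinct `i, j ∈ [n]`, and `w ∈ ℝ^n_{≥0}`.
> Thus the `1`-Rayleigh property of multi-affine polynomials is equivalent to the Rayleigh property for discrete
> probability measures studied in [Wag08] and [BBL09].

and §2.5 (p. 23): "A multi-affine polynomial `f` is said to be *strongly Rayleigh* if
`f(w) ∂_i∂_j f(w) ≤ ∂_i f(w) ∂_j f(w)` for all distinct `i, j ∈ [n]`, `w ∈ ℝ^n`. Clearly, any strongly Rayleigh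
multi-affine polynomial is `1`-Rayleigh."

## Proof (the source gives none; the only point is the passage from `α = 0` to all `α`)

For a multi-affine `f = multiAffine μ`, `∂^α f` vanishes unless `α` is square-free, and for square-free `α = 1_T`
it is again multi-affine, `∂^T f = multiAffine (∂_T μ)` with the iterated derivative weight
(`NegativeDependence.derivWeight`, `iterPderiv_single_multiAffine`). The pairwise condition passes from `f` to
`∂_e f` by Borcea–Brändén–Liggett's argument for their Prop. 2.1 (1): the condition for `f` at `w` with `w_e = t`
is a quadratic in `t`, nonnegative for all `t > 0`, whose leading coefficient is the condition for `∂_e f` at `w`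
(`pairwise_derivWeight`, tree `nonneg_of_forall_pos_quadratic_nonneg`). The diagonal case `i = j` of Def. 2.18 is
`0 ≤ c (∂^{α+e_i} f)²` for multi-affine `f`, whence the hypothesis `c ≥ 0` (the source fixes `c > 0`).

## Contents

* §1 `pderiv_pderiv_multiAffine`, `iterPderiv_single_multiAffine`, `exists_iterPderiv_multiAffine_eq`
  (`∂^α (multiAffine μ) = multiAffine ρ` with `ρ` again nonnegative and pairwise `c`-Rayleigh),
  `pairwise_derivWeight`, `coeff_indicator_multiAffine`.
* §2 **`isCRayleigh_multiAffine_iff`** (the displayed equivalence, `c ≥ 0`), `isCRayleigh_iff_of_isMultiAffine`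
  (the same for any multi-affine `f`).
* §3 **`isCRayleigh_one_multiAffine_iff`** ("`1`-Rayleigh ⟺ Rayleigh measure of [Wag08], [BBL09]", i.e. the tree's
  `IsRayleigh` plus nonnegativity), `isCRayleigh_one_iff_of_isMultiAffine`, `isCRayleigh_one_of_stableOrZero` ("any
  strongly Rayleigh multi-affine polynomial is `1`-Rayleigh"), and the transfer of BBL Thm. 4.10 to `1`-Rayleigh
  homogeneous multi-affine polynomials (`IsCRayleigh.negAssoc_pin_extField`).

## References

* [BrandenHuh2019] P. Brändén, J. Huh, Lorentzian polynomials, Ann. of Math. 192 (2020); arXiv:1902.03719 — §2.4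
  Def. 2.18 and the remark following it; §2.5 (strongly Rayleigh ⇒ `1`-Rayleigh).
* [BorceaBrandenLiggett2007] J. Borcea, P. Brändén, T. M. Liggett, Negative dependence and the geometry of
  polynomials, J. Amer. Math. Soc. 22 (2009) — §2.1 Def. 2.5, Prop. 2.1 (1) (the `z_e → ∞` argument), Thm. 4.10.
* [Wagner2008] D. G. Wagner, Negatively correlated random variables and Mason's conjecture, Ann. Comb. 12 (2008).
-/

noncomputable section

open Finset MvPolynomial
open Literature.Probability.NegativeDependence
open Literature.Combinatorics.StablePolynomials
open Literature.Combinatorics.Sahi2008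

namespace Literature.Combinatorics.LorentzianPolynomials

variable {σ : Type*} [Fintype σ] [DecidableEq σ]

/-! ## §1 Iterated derivatives of multi-affine polynomials -/

section Derivatives

/-- `∂_i ∂_j (Σ_S μ(S) z^S) = Σ_T (∂_i∂_j μ)(T) z^T`. [cite: BrandenHuh2019, §2.4 (remark after Def. 2.18,
"`f(w) ∂_i∂_j f(w)`" for multi-affine `f`)] -/
theorem pderiv_pderiv_multiAffine (μ : Finset σ → ℝ) (i j : σ) :
    pderiv i (pderiv j (multiAffine μ)) = multiAffine (derivWeight i (derivWeight j μ)) := by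
  rw [pderiv_multiAffine_eq, pderiv_multiAffine_eq]

/-- `∂_a^b (Σ_S μ(S) z^S) = Σ_T (∂_a^b μ)(T) z^T` (zero for `b ≥ 2`). [cite: BrandenHuh2019, §2.4 Def. 2.18 (`∂^α`)] -/
theorem iterPderiv_single_multiAffine (a : σ) (b : ℕ) (μ : Finset σ → ℝ) :
    iterPderiv (Finsupp.single a b) (multiAffine μ) = multiAffine ((derivWeight a)^[b] μ) := by
  induction b with
  | zero => rw [Finsupp.single_zero, iterPderiv_zero, Function.iterate_zero, id]
  | succ b ih =>
    rw [Finsupp.single_add, iterPderiv_add_single, ih, pderiv_multiAffine_eq, Function.iterate_succ_apply']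

omit [DecidableEq σ] in
/-- The coefficient of the square-free monomial `z^S` in `Σ_T μ(T) z^T` is `μ(S)` (real coefficients).
[cite: BrandenHuh2019, §2.4 Def. 2.18 ("`f` has nonnegative coefficients")] -/
theorem coeff_indicator_multiAffine (μ : Finset σ → ℝ) (S : Finset σ) :
    coeff (∑ i ∈ S, Finsupp.single i 1) (multiAffine μ) = μ S := by
  have h := coeff_multiAffine_indicator (fun T => (algebraMap ℝ ℂ) (μ T)) S
  rw [show (multiAffine fun T => (algebraMap ℝ ℂ) (μ T)) = MvPolynomial.map (algebraMap ℝ ℂ) (multiAffine μ) by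
    rw [map_multiAffine]; rfl, coeff_map] at h
  exact_mod_cast h

omit [DecidableEq σ] in
/-- Nonnegative coefficients of `Σ_S μ(S) z^S` means `μ ≥ 0`. [cite: BrandenHuh2019, §2.4 Def. 2.18] -/
theorem forall_coeff_multiAffine_nonneg_iff (μ : Finset σ → ℝ) : (∀ m, 0 ≤ coeff m (multiAffine μ)) ↔ ∀ S, 0 ≤ μ S := by
  refine ⟨fun h S => ?_, fun h m => coeff_multiAffine_nonneg h m⟩
  rw [← coeff_indicator_multiAffine μ S]
  exact h _

/-- **The pairwise condition passes to `∂_e f`** (BBL's proof of their Prop. 2.1 (1), for any constant `c`): if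
`g_μ(w) g_{∂_i∂_jμ}(w) ≤ c g_{∂_iμ}(w) g_{∂_jμ}(w)` on the closed orthant for all `i ≠ j`, then the same holds for
`∂_e μ`. [cite: BorceaBrandenLiggett2007, §2.1 proof of Prop. 2.1 (1); BrandenHuh2019, §2.4 (remark after Def. 2.18)] -/
theorem pairwise_derivWeight {c : ℝ} {μ : Finset σ → ℝ}
    (h : ∀ i j : σ, i ≠ j → ∀ w : σ → ℝ, (∀ k, 0 ≤ w k) →
      MvPolynomial.eval w (multiAffine μ) * MvPolynomial.eval w (multiAffine (derivWeight i (derivWeight j μ))) ≤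
        c * (MvPolynomial.eval w (multiAffine (derivWeight i μ)) * MvPolynomial.eval w (multiAffine (derivWeight j μ))))
    (e : σ) (i j : σ) (hij : i ≠ j) (w : σ → ℝ) (hw : ∀ k, 0 ≤ w k) :
    MvPolynomial.eval w (multiAffine (derivWeight e μ)) *
        MvPolynomial.eval w (multiAffine (derivWeight i (derivWeight j (derivWeight e μ)))) ≤
      c * (MvPolynomial.eval w (multiAffine (derivWeight i (derivWeight e μ))) *
        MvPolynomial.eval w (multiAffine (derivWeight j (derivWeight e μ)))) := by
  -- the condition for `μ` at `w` with `w_e := t`, as a quadratic in `t > 0`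
  have key : ∀ t : ℝ, 0 < t →
      0 ≤ (c * (MvPolynomial.eval w (multiAffine (derivWeight i (derivWeight e μ))) *
                MvPolynomial.eval w (multiAffine (derivWeight j (derivWeight e μ)))) -
            MvPolynomial.eval w (multiAffine (derivWeight e μ)) *
              MvPolynomial.eval w (multiAffine (derivWeight i (derivWeight j (derivWeight e μ))))) * t ^ 2 +
          (c * (MvPolynomial.eval w (multiAffine (derivWeight i (derivWeight e μ))) *
                  MvPolynomial.eval w (multiAffine (pinOut e (derivWeight j μ))) +
                MvPolynomial.eval w (multiAffine (pinOut e (derivWeight i μ))) *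
                  MvPolynomial.eval w (multiAffine (derivWeight j (derivWeight e μ)))) -
            (MvPolynomial.eval w (multiAffine (derivWeight e μ)) *
                MvPolynomial.eval w (multiAffine (pinOut e (derivWeight i (derivWeight j μ)))) +
              MvPolynomial.eval w (multiAffine (pinOut e μ)) *
                MvPolynomial.eval w (multiAffine (derivWeight i (derivWeight j (derivWeight e μ)))))) * t +
          (c * (MvPolynomial.eval w (multiAffine (pinOut e (derivWeight i μ))) *
                MvPolynomial.eval w (multiAffine (pinOut e (derivWeight j μ)))) -
            MvPolynomial.eval w (multiAffine (pinOut e μ)) *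
              MvPolynomial.eval w (multiAffine (pinOut e (derivWeight i (derivWeight j μ))))) := by
    intro t ht
    have hwt : ∀ k, 0 ≤ Function.update w e t k := fun k => by
      rcases eq_or_ne k e with rfl | hk
      · rw [Function.update_self]; exact ht.le
      · rw [Function.update_of_ne hk]; exact hw k
    have hR := sub_nonneg.2 (h i j hij (Function.update w e t) hwt)
    rw [eval_update_multiAffine, eval_update_multiAffine, eval_update_multiAffine, eval_update_multiAffine,
      derivWeight_comm e i (derivWeight j μ), derivWeight_comm e j μ, derivWeight_comm e i μ] at hR
    convert hR using 1
    ring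
  exact sub_nonneg.1 (nonneg_of_forall_pos_quadratic_nonneg key)

/-- Iterating: the pairwise condition and nonnegativity pass to `∂_a^b μ`. [cite: BorceaBrandenLiggett2007, §2.1
Prop. 2.1 (1) ("by induction")] -/
theorem pairwise_iterate_derivWeight {c : ℝ} {μ : Finset σ → ℝ} (h0 : ∀ S, 0 ≤ μ S)
    (h : ∀ i j : σ, i ≠ j → ∀ w : σ → ℝ, (∀ k, 0 ≤ w k) →
      MvPolynomial.eval w (multiAffine μ) * MvPolynomial.eval w (multiAffine (derivWeight i (derivWeight j μ))) ≤
        c * (MvPolynomial.eval w (multiAffine (derivWeight i μ)) * MvPolynomial.eval w (multiAffine (derivWeight j μ))))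
    (a : σ) (b : ℕ) :
    (∀ S, 0 ≤ ((derivWeight a)^[b] μ) S) ∧
      ∀ i j : σ, i ≠ j → ∀ w : σ → ℝ, (∀ k, 0 ≤ w k) →
        MvPolynomial.eval w (multiAffine ((derivWeight a)^[b] μ)) *
            MvPolynomial.eval w (multiAffine (derivWeight i (derivWeight j ((derivWeight a)^[b] μ)))) ≤
          c * (MvPolynomial.eval w (multiAffine (derivWeight i ((derivWeight a)^[b] μ))) *
            MvPolynomial.eval w (multiAffine (derivWeight j ((derivWeight a)^[b] μ)))) := by
  induction b with
  | zero => exact ⟨h0, h⟩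
  | succ b ih =>
    rw [Function.iterate_succ_apply']
    exact ⟨derivWeight_nonneg ih.1 a, fun i j hij w hw => pairwise_derivWeight ih.2 a i j hij w hw⟩

/-- **`∂^α` of a multi-affine polynomial with the pairwise `c`-Rayleigh condition is again of this form**:
`∂^α (Σ_S μ(S) z^S) = Σ_T ρ(T) z^T` with `ρ ≥ 0` satisfying the pairwise condition (the zero weight if `α` is not
square-free). [cite: BrandenHuh2019, §2.4 (remark after Def. 2.18); BorceaBrandenLiggett2007, §2.1 Prop. 2.1 (1)] -/
theorem exists_iterPderiv_multiAffine_eq {c : ℝ} (α : σ →₀ ℕ) :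
    ∀ μ : Finset σ → ℝ, (∀ S, 0 ≤ μ S) →
      (∀ i j : σ, i ≠ j → ∀ w : σ → ℝ, (∀ k, 0 ≤ w k) →
        MvPolynomial.eval w (multiAffine μ) * MvPolynomial.eval w (multiAffine (derivWeight i (derivWeight j μ))) ≤
          c * (MvPolynomial.eval w (multiAffine (derivWeight i μ)) *
            MvPolynomial.eval w (multiAffine (derivWeight j μ)))) →
      ∃ ρ : Finset σ → ℝ, (∀ S, 0 ≤ ρ S) ∧
        (∀ i j : σ, i ≠ j → ∀ w : σ → ℝ, (∀ k, 0 ≤ w k) →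
          MvPolynomial.eval w (multiAffine ρ) * MvPolynomial.eval w (multiAffine (derivWeight i (derivWeight j ρ))) ≤
            c * (MvPolynomial.eval w (multiAffine (derivWeight i ρ)) *
              MvPolynomial.eval w (multiAffine (derivWeight j ρ)))) ∧
        iterPderiv α (multiAffine μ) = multiAffine ρ := by
  induction α using Finsupp.induction with
  | zero => exact fun μ h0 h => ⟨μ, h0, h, iterPderiv_zero _⟩
  | single_add a b f _ _ ih =>
    intro μ h0 h
    obtain ⟨h0', h'⟩ := pairwise_iterate_derivWeight h0 h a b
    obtain ⟨ρ, hρ0, hρ, hρeq⟩ := ih _ h0' h'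
    refine ⟨ρ, hρ0, hρ, ?_⟩
    rw [add_comm, ← iterPderiv_iterPderiv, iterPderiv_single_multiAffine, hρeq]

end Derivatives

/-! ## §2 The pairwise criterion for multi-affine polynomials -/

section Pairwise

/-- **Brändén–Huh, §2.4 (after Def. 2.18): for multi-affine `f` the `c`-Rayleigh condition is equivalent to
`f(w) ∂_i∂_j f(w) ≤ c ∂_i f(w) ∂_j f(w)` for all distinct `i, j` and `w ∈ ℝ^n_{≥0}`** — here for `f = Σ_S μ(S) z^S`
(with the nonnegativity of the coefficients, which Def. 2.18 includes, made explicit; `c ≥ 0`).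
[cite: BrandenHuh2019, §2.4 remark after Def. 2.18] -/
theorem isCRayleigh_multiAffine_iff {c : ℝ} (hc : 0 ≤ c) (μ : Finset σ → ℝ) :
    IsCRayleigh c (multiAffine μ) ↔ (∀ S, 0 ≤ μ S) ∧
      ∀ i j : σ, i ≠ j → ∀ w : σ → ℝ, (∀ k, 0 ≤ w k) →
        MvPolynomial.eval w (multiAffine μ) * MvPolynomial.eval w (pderiv i (pderiv j (multiAffine μ))) ≤
          c * (MvPolynomial.eval w (pderiv i (multiAffine μ)) * MvPolynomial.eval w (pderiv j (multiAffine μ))) := by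
  constructor
  · intro h
    exact ⟨(forall_coeff_multiAffine_nonneg_iff μ).1 h.1, fun i j _ w hw => h.eval_mul_eval_pderiv_pderiv_le i j hw⟩
  · rintro ⟨h0, h⟩
    simp only [pderiv_multiAffine_eq] at h
    refine ⟨(forall_coeff_multiAffine_nonneg_iff μ).2 h0, fun α i j w hw => ?_⟩
    obtain ⟨ρ, hρ0, hρ, hρeq⟩ := exists_iterPderiv_multiAffine_eq α μ h0 h
    rw [iterPderiv_add_single, iterPderiv_add_single, iterPderiv_add_single, hρeq]
    simp only [pderiv_multiAffine_eq]
    rcases eq_or_ne i j with rfl | hij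
    · rw [derivWeight_derivWeight_self]
      have hz : multiAffine (0 : Finset σ → ℝ) = 0 := by simp [multiAffine]
      rw [hz, map_zero, mul_zero]
      exact mul_nonneg hc (mul_self_nonneg _)
    · rw [derivWeight_comm j i]
      exact hρ i j hij w hw

/-- A real multi-affine polynomial is `Σ_S [z^S]f · z^S`. [cite: BrandenHuh2019, §2.4 ("when `f` has degree at most
one in each variable")] -/
private theorem eq_multiAffine_coeff {f : MvPolynomial σ ℝ} (hf : IsMultiAffine f) :
    f = multiAffine fun S => coeff (∑ i ∈ S, Finsupp.single i 1) f := by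
  apply MvPolynomial.map_injective (algebraMap ℝ ℂ) (RingHom.injective _)
  rw [map_multiAffine, eq_multiAffine_of_isMultiAffine (isMultiAffine_map_algebraMap hf)]
  congr 1

/-- **The same criterion for an arbitrary multi-affine `f ∈ ℝ[w_1,…,w_n]`** ("when `f` has degree at most one in
each variable, the `c`-Rayleigh condition for `f` is equivalent to `f ∂_i∂_j f ≤ c ∂_i f ∂_j f` for all distinct
`i, j` and `w ≥ 0`", plus nonnegative coefficients). [cite: BrandenHuh2019, §2.4 remark after Def. 2.18] -/
theorem isCRayleigh_iff_of_isMultiAffine {c : ℝ} (hc : 0 ≤ c) {f : MvPolynomial σ ℝ} (hf : IsMultiAffine f) :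
    IsCRayleigh c f ↔ (∀ m, 0 ≤ coeff m f) ∧
      ∀ i j : σ, i ≠ j → ∀ w : σ → ℝ, (∀ k, 0 ≤ w k) →
        MvPolynomial.eval w f * MvPolynomial.eval w (pderiv i (pderiv j f)) ≤
          c * (MvPolynomial.eval w (pderiv i f) * MvPolynomial.eval w (pderiv j f)) := by
  have hf' := eq_multiAffine_coeff hf
  constructor
  · intro h
    exact ⟨h.1, fun i j _ w hw => h.eval_mul_eval_pderiv_pderiv_le i j hw⟩
  · rintro ⟨h0, h⟩
    rw [hf'] at h ⊢
    exact (isCRayleigh_multiAffine_iff hc _).2 ⟨fun S => h0 _, h⟩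

end Pairwise

/-! ## §3 `1`-Rayleigh multi-affine polynomials = Rayleigh measures (Wagner, Borcea–Brändén–Liggett) -/

section One

/-- **"The `1`-Rayleigh property of multi-affine polynomials is equivalent to the Rayleigh property for discrete
probability measures studied in [Wag08] and [BBL09]"**: for a weight `μ` on `2^σ`, `Σ_S μ(S) z^S` is `1`-Rayleigh
(Brändén–Huh Def. 2.18) iff `μ ≥ 0` and `μ` is Rayleigh in the sense of Borcea–Brändén–Liggett Def. 2.5 (the tree's
`IsRayleigh`: Rayleigh differences nonnegative on the open orthant). [cite: BrandenHuh2019, §2.4 remark after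
Def. 2.18; BorceaBrandenLiggett2007, §2.1 Def. 2.5] -/
theorem isCRayleigh_one_multiAffine_iff (μ : Finset σ → ℝ) :
    IsCRayleigh 1 (multiAffine μ) ↔ (∀ S, 0 ≤ μ S) ∧ IsRayleigh μ := by
  rw [isCRayleigh_multiAffine_iff zero_le_one]
  refine and_congr_right fun _ => ⟨fun h => ?_, fun h i j _ w hw => ?_⟩
  · refine isRayleigh_of_forall_nonneg fun w hw i j => ?_
    rw [eval_rayleighDiff_multiAffine]
    rcases eq_or_ne i j with rfl | hij
    · rw [derivWeight_derivWeight_self]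
      have hz : multiAffine (0 : Finset σ → ℝ) = 0 := by simp [multiAffine]
      rw [hz, map_zero, zero_mul, sub_zero]
      exact mul_self_nonneg _
    · have key := h i j hij w hw
      rw [pderiv_pderiv_multiAffine, pderiv_multiAffine_eq, pderiv_multiAffine_eq, one_mul] at key
      linarith
  · have key := h.le_of_nonneg hw i j
    rw [pderiv_pderiv_multiAffine, pderiv_multiAffine_eq, pderiv_multiAffine_eq, one_mul]
    linarith

/-- The same for an arbitrary multi-affine `f`: `f` is `1`-Rayleigh iff its coefficient weight `S ↦ [z^S] f` is
nonnegative and Rayleigh. [cite: BrandenHuh2019, §2.4 remark after Def. 2.18] -/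
theorem isCRayleigh_one_iff_of_isMultiAffine {f : MvPolynomial σ ℝ} (hf : IsMultiAffine f) :
    IsCRayleigh 1 f ↔ (∀ m, 0 ≤ coeff m f) ∧ IsRayleigh (fun S => coeff (∑ i ∈ S, Finsupp.single i 1) f) := by
  have hf' := eq_multiAffine_coeff hf
  rw [hf', isCRayleigh_one_multiAffine_iff, ← hf']
  refine and_congr_left fun _ => ⟨fun h m => ?_, fun h S => h _⟩
  rw [hf']
  exact coeff_multiAffine_nonneg h m

/-- **"Clearly, any strongly Rayleigh multi-affine polynomial is `1`-Rayleigh"** (for a nonnegative weight whose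
generating polynomial is real stable or zero; Brändén's theorem gives the Rayleigh inequalities at every real point).
[cite: BrandenHuh2019, §2.5 (before Thm. 2.23); BorceaBrandenLiggett2007, §4 Thm. 4.1] -/
theorem isCRayleigh_one_of_stableOrZero {μ : Finset σ → ℝ} (h : StableOrZero μ) (h0 : ∀ S, 0 ≤ μ S) :
    IsCRayleigh 1 (multiAffine μ) :=
  (isCRayleigh_one_multiAffine_iff μ).2 ⟨h0, h.isRayleigh⟩

/-- **Transfer of Borcea–Brändén–Liggett Thm. 4.10**: a homogeneous `1`-Rayleigh multi-affine polynomial is the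
generating polynomial of a PHR measure, hence conditionally negatively associated — `E[FG] μ(Ω) ≤ E[F] E[G]` for
increasing `F, G` depending on disjoint coordinate sets, under every conditioning and external field.
[cite: BrandenHuh2019, §2.4 remark after Def. 2.18; BorceaBrandenLiggett2007, §4.2 Thm. 4.10] -/
theorem IsCRayleigh.negAssoc_pin_extField {μ : Finset σ → ℝ} (h : IsCRayleigh 1 (multiAffine μ))
    (hhom : IsHomogeneous μ) {a : σ → ℝ} (ha : ∀ i, 0 ≤ a i) (I O : Finset σ) {F G : Finset σ → ℝ}
    (hF : Monotone F) (hG : Monotone G) {E₁ E₂ : Finset σ} (hFE : DeterminedBy F E₁) (hGE : DeterminedBy G E₂)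
    (hdisj : Disjoint E₁ E₂) :
    ex (pin I O (extField a μ)) (F * G) * mass (pin I O (extField a μ)) ≤
      ex (pin I O (extField a μ)) F * ex (pin I O (extField a μ)) G := by
  obtain ⟨h0, hR⟩ := (isCRayleigh_one_multiAffine_iff μ).1 h
  exact (isPHR_of_isHomogeneous hR h0 hhom).negAssoc_pin_extField ha I O hF hG hFE hGE hdisj

end One

end Literature.Combinatorics.LorentzianPolynomials

end
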